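import Mathlib
import HarnessLib
import Literature.MathematicalPhysics.QuantumLattice.HubbardTwoPointMoments
import Literature.MathematicalPhysics.QuantumLattice.HubbardVertexCoefficientLimit

/-!
# Route `KLProgramme` — gen-4 child 5 `KLRegimeVolumeLimitV12` (stmt-HubbardSuperconductivity-19858), registered stub `stub_vl_bound`:
# the SIX-POINT (current–current) word of the finite-cutoff Schwinger–Dyson form and its limiting Wick determinant — INTERFACE
# (seat hubbard-kl-k3c5-p1 g4; TAU-BRIDGE.md §6 Step 3, HOME/hubbard-kl-k3c5-p2)

WHY.  By `…VolumeLimitDysonHartreeCurrent` (k3c5-p2) and `…VolumeLimitOccupation` (k3c5-p3), at finite cutoff `M`, every real `U` and every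
volume with bare `D_M(U) ≠ 0`, the bare-frame VL carrier is `Σ̂⁰_{L,M}(k,σ) = U·a_M + U²·βL²·b_M(k,σ)/D_M` with the occupation ratio `a_M`
bounded eventually in `M` (`norm_klSelfEnergy_bare_sub_sixPoint_le_eventually`); what remains of clause (i) is the CURRENT–CURRENT insertion
`b_M(k,σ) = ∫dμ_C e^{−V}(∂⁺_{kσ}W)(∂⁻_{kσ}W)`.  In position–time fields it is a Fourier coefficient of the two-time correlation of the two local
cubic words `J̄_{z,s} = ψ⁺_{(z,s)σ}ψ⁺_{(z,s)τ}ψ⁻_{(z,s)τ}` and `J_{0,0} = ψ⁺_{(0,0)τ}ψ⁻_{(0,0)τ}ψ⁻_{(0,0)σ}` (`τ` = the partner spin; step (F)); its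
`M → ∞` limit (step (Z1), the Grassmann half, t2's all-`U` template with three external legs of each charge) and the identification of that
limit with the Hamiltonian two-time correlation `Tr(e^{−(β−s)H′} c†_{zσ}(n_{zτ} − ½) e^{−sH′} (n_{0τ} − ½)c_{0σ})` (step (Z2), the Hamiltonian
half) meet at ONE object, fixed here so that the two halves can be typed independently:

* `sixPointPlusEnum n σ τ` / `sixPointMinusEnum n σ τ` — the enumerations of the `2n + 3` barred / unbarred legs of the word
  `ψ⁺_{(z,s)σ}ψ⁻_{(0,0)σ} · ψ⁺_{(z,s)τ}ψ⁻_{(z,s)τ} · ψ⁺_{(0,0)τ}ψ⁻_{(0,0)τ} · Π_a ψ⁺_{a↑}ψ⁻_{a↑}ψ⁺_{a↓}ψ⁻_{a↓}` on the configuration of `n + 2`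
  points (vertices `castAdd 2 a`; external point `natAdd n 0` = `(z, s)`, external point `natAdd n 1` = `(0, 0)`): pair `0` is the SPLIT pair
  (creation at `(z,s)`, annihilation at `(0,0)`, spin `σ`), pairs `1`, `2` the two partner-spin densities, pairs `3 + 2a + ς` the vertices;
* `sixPointWord L M β σ τ z s` — the Grassmann word (the three external pairs in this order; `= J̄_{z,s}·J_{0,0}`, `sixPointWord_eq_currents`);
* `sixPointLimitDet L β μ σ τ z s x t` — `det[vertexLimitEntry(x⃗′_{pᵢ}, x⃗′_{qⱼ}, σᵢ, σⱼ; t′_{qⱼ} − t′_{pᵢ})]_{i,j < 2n+3}`, `x⃗′ = (x⃗, z, 0)`,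
  `t′ = (t, s, 0)` — the limiting Wick determinant (midpoint values at equal times);
* `gaussExpect_sixPointWord_mul_hubbardInteraction_pow_eq_det` — at finite cutoff the `n`-th moment `∫dμ_{C_M} (sixPointWord) Vⁿ` IS
  `Uⁿ Σ_{x⃗} ∫_{[0,β]ⁿ} det[−(S′ᵀC_MS′)((P i,+),(Q j,−))]` (the enumerations are the right ones);
* injectivity of the two enumerations (each point carries at most two legs of each charge — the input of t2's domination).

Bookkeeping definitions and the finite-`M` Wick identity only; nothing about limits is asserted here.
-/

noncomputable section

namespace Summit.HubbardSuperconductivity.HubbardSuperconductivity.Theorems.TwoPointAssembly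

set_option linter.dupNamespace false -- summit = problem name (single-conjunct summit), D-0017

open Finset MeasureTheory Literature.MathematicalPhysics.QuantumLattice Literature.Probability.LatticeModels GrassmannAlgebra

/-! ## §1 The leg enumerations of the six-point word -/

/-- The vertex legs behind the three external pairs (shared tail of both enumerations). -/
def sixPointVertexLeg (n : ℕ) (m : Fin (n * 2)) : Fin (n + 2) × Fin 2 :=
  (Fin.castAdd 2 (finProdFinEquiv.symm m : Fin n × Fin 2).1, (finProdFinEquiv.symm m : Fin n × Fin 2).2)

/-- **Barred legs** of the six-point word: pair `0` = `ψ⁺_{(z,s)σ}`, pair `1` = `ψ⁺_{(z,s)τ}`, pair `2` = `ψ⁺_{(0,0)τ}`, then the vertices. -/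
def sixPointPlusEnum (n : ℕ) (σ τ : Fin 2) : Fin (n * 2 + 3) → Fin (n + 2) × Fin 2 :=
  Fin.cons (Fin.natAdd n (0 : Fin 2), σ) <| Fin.cons (Fin.natAdd n (0 : Fin 2), τ) <|
    Fin.cons (Fin.natAdd n (1 : Fin 2), τ) (sixPointVertexLeg n)

/-- **Unbarred legs** of the six-point word: pair `0` = `ψ⁻_{(0,0)σ}`, pair `1` = `ψ⁻_{(z,s)τ}`, pair `2` = `ψ⁻_{(0,0)τ}`, then the vertices. -/
def sixPointMinusEnum (n : ℕ) (σ τ : Fin 2) : Fin (n * 2 + 3) → Fin (n + 2) × Fin 2 :=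
  Fin.cons (Fin.natAdd n (1 : Fin 2), σ) <| Fin.cons (Fin.natAdd n (0 : Fin 2), τ) <|
    Fin.cons (Fin.natAdd n (1 : Fin 2), τ) (sixPointVertexLeg n)

/-- Pair `0` of the barred enumeration: `ψ⁺_{(z,s)σ}`. -/
@[simp] theorem sixPointPlusEnum_zero (n : ℕ) (σ τ : Fin 2) : sixPointPlusEnum n σ τ 0 = (Fin.natAdd n (0 : Fin 2), σ) := rfl

/-- Pair `1` of the barred enumeration: `ψ⁺_{(z,s)τ}`. -/
@[simp] theorem sixPointPlusEnum_one (n : ℕ) (σ τ : Fin 2) : sixPointPlusEnum n σ τ 1 = (Fin.natAdd n (0 : Fin 2), τ) := rfl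

/-- Pair `2` of the barred enumeration: `ψ⁺_{(0,0)τ}`. -/
@[simp] theorem sixPointPlusEnum_two (n : ℕ) (σ τ : Fin 2) : sixPointPlusEnum n σ τ 2 = (Fin.natAdd n (1 : Fin 2), τ) := rfl

/-- Pair `0` of the unbarred enumeration: `ψ⁻_{(0,0)σ}`. -/
@[simp] theorem sixPointMinusEnum_zero (n : ℕ) (σ τ : Fin 2) : sixPointMinusEnum n σ τ 0 = (Fin.natAdd n (1 : Fin 2), σ) := rfl

/-- Pair `1` of the unbarred enumeration: `ψ⁻_{(z,s)τ}`. -/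
@[simp] theorem sixPointMinusEnum_one (n : ℕ) (σ τ : Fin 2) : sixPointMinusEnum n σ τ 1 = (Fin.natAdd n (0 : Fin 2), τ) := rfl

/-- Pair `2` of the unbarred enumeration: `ψ⁻_{(0,0)τ}`. -/
@[simp] theorem sixPointMinusEnum_two (n : ℕ) (σ τ : Fin 2) : sixPointMinusEnum n σ τ 2 = (Fin.natAdd n (1 : Fin 2), τ) := rfl

/-- The vertex legs of the barred enumeration: index `m.succ.succ.succ`. -/
@[simp] theorem sixPointPlusEnum_succ_succ_succ (n : ℕ) (σ τ : Fin 2) (m : Fin (n * 2)) :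
    sixPointPlusEnum n σ τ m.succ.succ.succ = sixPointVertexLeg n m := rfl

/-- The vertex legs of the unbarred enumeration: index `m.succ.succ.succ`. -/
@[simp] theorem sixPointMinusEnum_succ_succ_succ (n : ℕ) (σ τ : Fin 2) (m : Fin (n * 2)) :
    sixPointMinusEnum n σ τ m.succ.succ.succ = sixPointVertexLeg n m := rfl

/-- The shared vertex tail is injective. -/
theorem sixPointVertexLeg_injective (n : ℕ) : Function.Injective (sixPointVertexLeg n) := by
  intro m m' h
  simp only [sixPointVertexLeg, Prod.mk.injEq] at h
  have h1 : (finProdFinEquiv.symm m : Fin n × Fin 2).1 = (finProdFinEquiv.symm m' : Fin n × Fin 2).1 :=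
    Fin.castAdd_injective _ _ h.1
  exact finProdFinEquiv.symm.injective (Prod.ext h1 h.2)

/-- A vertex leg is never an external leg. -/
theorem sixPointVertexLeg_fst_ne_natAdd (n : ℕ) (m : Fin (n * 2)) (j : Fin 2) : (sixPointVertexLeg n m).1 ≠ Fin.natAdd n j := by
  intro h
  have h' := congrArg (fun p : Fin (n + 2) => (p : ℕ)) h
  simp only [sixPointVertexLeg, Fin.val_castAdd, Fin.val_natAdd] at h'
  have := (finProdFinEquiv.symm m : Fin n × Fin 2).1.isLt
  omega

/-- **The barred enumeration is injective** when the two spins differ (each point carries at most two barred legs). -/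
theorem sixPointPlusEnum_injective (n : ℕ) {σ τ : Fin 2} (hστ : σ ≠ τ) : Function.Injective (sixPointPlusEnum n σ τ) := by
  intro i j h
  induction i using Fin.cases with
  | zero =>
    induction j using Fin.cases with
    | zero => rfl
    | succ j =>
      induction j using Fin.cases with
      | zero => simp [sixPointPlusEnum, hστ] at h
      | succ j =>
        induction j using Fin.cases with
        | zero =>
          simp only [sixPointPlusEnum, Fin.cons_zero, Fin.cons_succ, Prod.mk.injEq] at h
          exact absurd (Fin.natAdd_injective _ _ h.1 : (0 : Fin 2) = 1) (by decide)
        | succ m =>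
          rw [sixPointPlusEnum_zero, sixPointPlusEnum_succ_succ_succ] at h
          exact absurd (congrArg Prod.fst h).symm (sixPointVertexLeg_fst_ne_natAdd n m 0)
  | succ i =>
    induction i using Fin.cases with
    | zero =>
      induction j using Fin.cases with
      | zero => simp [sixPointPlusEnum, Ne.symm hστ] at h
      | succ j =>
        induction j using Fin.cases with
        | zero => rfl
        | succ j =>
          induction j using Fin.cases with
          | zero =>
            simp only [sixPointPlusEnum, Fin.cons_zero, Fin.cons_succ, Prod.mk.injEq] at h
            exact absurd (Fin.natAdd_injective _ _ h.1 : (0 : Fin 2) = 1) (by decide)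
          | succ m =>
            rw [show (Fin.succ (0 : Fin (n * 2 + 2))) = 1 from rfl, sixPointPlusEnum_one, sixPointPlusEnum_succ_succ_succ] at h
            exact absurd (congrArg Prod.fst h).symm (sixPointVertexLeg_fst_ne_natAdd n m 0)
    | succ i =>
      induction i using Fin.cases with
      | zero =>
        induction j using Fin.cases with
        | zero =>
          simp only [sixPointPlusEnum, Fin.cons_zero, Fin.cons_succ, Prod.mk.injEq] at h
          exact absurd (Fin.natAdd_injective _ _ h.1 : (1 : Fin 2) = 0) (by decide)
        | succ j =>
          induction j using Fin.cases with
          | zero =>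
            simp only [sixPointPlusEnum, Fin.cons_zero, Fin.cons_succ, Prod.mk.injEq] at h
            exact absurd (Fin.natAdd_injective _ _ h.1 : (1 : Fin 2) = 0) (by decide)
          | succ j =>
            induction j using Fin.cases with
            | zero => rfl
            | succ m =>
              rw [show (Fin.succ (Fin.succ (0 : Fin (n * 2 + 1)))) = 2 from rfl, sixPointPlusEnum_two,
                sixPointPlusEnum_succ_succ_succ] at h
              exact absurd (congrArg Prod.fst h).symm (sixPointVertexLeg_fst_ne_natAdd n m 1)
      | succ m =>
        induction j using Fin.cases with
        | zero =>
          rw [sixPointPlusEnum_zero, sixPointPlusEnum_succ_succ_succ] at h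
          exact absurd (congrArg Prod.fst h) (sixPointVertexLeg_fst_ne_natAdd n m 0)
        | succ j =>
          induction j using Fin.cases with
          | zero =>
            rw [show (Fin.succ (0 : Fin (n * 2 + 2))) = 1 from rfl, sixPointPlusEnum_one, sixPointPlusEnum_succ_succ_succ] at h
            exact absurd (congrArg Prod.fst h) (sixPointVertexLeg_fst_ne_natAdd n m 0)
          | succ j =>
            induction j using Fin.cases with
            | zero =>
              rw [show (Fin.succ (Fin.succ (0 : Fin (n * 2 + 1)))) = 2 from rfl, sixPointPlusEnum_two,
                sixPointPlusEnum_succ_succ_succ] at h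
              exact absurd (congrArg Prod.fst h) (sixPointVertexLeg_fst_ne_natAdd n m 1)
            | succ m' =>
              rw [sixPointPlusEnum_succ_succ_succ, sixPointPlusEnum_succ_succ_succ] at h
              rw [sixPointVertexLeg_injective n h]

/-- **The unbarred enumeration is injective** when the two spins differ (each point carries at most two unbarred legs). -/
theorem sixPointMinusEnum_injective (n : ℕ) {σ τ : Fin 2} (hστ : σ ≠ τ) : Function.Injective (sixPointMinusEnum n σ τ) := by
  intro i j h
  induction i using Fin.cases with
  | zero =>
    induction j using Fin.cases with
    | zero => rfl
    | succ j =>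
      induction j using Fin.cases with
      | zero =>
        simp only [sixPointMinusEnum, Fin.cons_zero, Fin.cons_succ, Prod.mk.injEq] at h
        exact absurd (Fin.natAdd_injective _ _ h.1 : (1 : Fin 2) = 0) (by decide)
      | succ j =>
        induction j using Fin.cases with
        | zero =>
          rw [show (Fin.succ (Fin.succ (0 : Fin (n * 2 + 1)))) = 2 from rfl, sixPointMinusEnum_zero, sixPointMinusEnum_two,
            Prod.mk.injEq] at h
          exact absurd h.2 hστ
        | succ m =>
          rw [sixPointMinusEnum_zero, sixPointMinusEnum_succ_succ_succ] at h
          exact absurd (congrArg Prod.fst h).symm (sixPointVertexLeg_fst_ne_natAdd n m 1)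
  | succ i =>
    induction i using Fin.cases with
    | zero =>
      induction j using Fin.cases with
      | zero =>
        simp only [sixPointMinusEnum, Fin.cons_zero, Fin.cons_succ, Prod.mk.injEq] at h
        exact absurd (Fin.natAdd_injective _ _ h.1 : (0 : Fin 2) = 1) (by decide)
      | succ j =>
        induction j using Fin.cases with
        | zero => rfl
        | succ j =>
          induction j using Fin.cases with
          | zero =>
            simp only [sixPointMinusEnum, Fin.cons_zero, Fin.cons_succ, Prod.mk.injEq] at h
            exact absurd (Fin.natAdd_injective _ _ h.1 : (0 : Fin 2) = 1) (by decide)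
          | succ m =>
            rw [show (Fin.succ (0 : Fin (n * 2 + 2))) = 1 from rfl, sixPointMinusEnum_one, sixPointMinusEnum_succ_succ_succ] at h
            exact absurd (congrArg Prod.fst h).symm (sixPointVertexLeg_fst_ne_natAdd n m 0)
    | succ i =>
      induction i using Fin.cases with
      | zero =>
        induction j using Fin.cases with
        | zero =>
          rw [show (Fin.succ (Fin.succ (0 : Fin (n * 2 + 1)))) = 2 from rfl, sixPointMinusEnum_zero, sixPointMinusEnum_two,
            Prod.mk.injEq] at h
          exact absurd h.2.symm hστ
        | succ j =>
          induction j using Fin.cases with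
          | zero =>
            simp only [sixPointMinusEnum, Fin.cons_zero, Fin.cons_succ, Prod.mk.injEq] at h
            exact absurd (Fin.natAdd_injective _ _ h.1 : (1 : Fin 2) = 0) (by decide)
          | succ j =>
            induction j using Fin.cases with
            | zero => rfl
            | succ m =>
              rw [show (Fin.succ (Fin.succ (0 : Fin (n * 2 + 1)))) = 2 from rfl, sixPointMinusEnum_two,
                sixPointMinusEnum_succ_succ_succ] at h
              exact absurd (congrArg Prod.fst h).symm (sixPointVertexLeg_fst_ne_natAdd n m 1)
      | succ m =>
        induction j using Fin.cases with
        | zero =>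
          rw [sixPointMinusEnum_zero, sixPointMinusEnum_succ_succ_succ] at h
          exact absurd (congrArg Prod.fst h) (sixPointVertexLeg_fst_ne_natAdd n m 1)
        | succ j =>
          induction j using Fin.cases with
          | zero =>
            rw [show (Fin.succ (0 : Fin (n * 2 + 2))) = 1 from rfl, sixPointMinusEnum_one, sixPointMinusEnum_succ_succ_succ] at h
            exact absurd (congrArg Prod.fst h) (sixPointVertexLeg_fst_ne_natAdd n m 0)
          | succ j =>
            induction j using Fin.cases with
            | zero =>
              rw [show (Fin.succ (Fin.succ (0 : Fin (n * 2 + 1)))) = 2 from rfl, sixPointMinusEnum_two,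
                sixPointMinusEnum_succ_succ_succ] at h
              exact absurd (congrArg Prod.fst h) (sixPointVertexLeg_fst_ne_natAdd n m 1)
            | succ m' =>
              rw [sixPointMinusEnum_succ_succ_succ, sixPointMinusEnum_succ_succ_succ] at h
              rw [sixPointVertexLeg_injective n h]

/-- Each point carries at most two BARRED legs of the six-point word (`σ ≠ τ`). -/
theorem card_filter_sixPointPlusEnum_fst_le_two (n : ℕ) {σ τ : Fin 2} (hστ : σ ≠ τ) (a : Fin (n + 2)) :
    (univ.filter fun i => (sixPointPlusEnum n σ τ i).1 = a).card ≤ 2 := by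
  classical
  have h := Finset.card_le_card_of_injOn (fun i => (sixPointPlusEnum n σ τ i).2)
    (s := univ.filter fun i => (sixPointPlusEnum n σ τ i).1 = a) (t := (univ : Finset (Fin 2))) (fun i _ => mem_univ _)
    (fun i hi i' hi' h2 => by
      have h1 : (sixPointPlusEnum n σ τ i).1 = (sixPointPlusEnum n σ τ i').1 := by
        rw [(mem_filter.mp (Finset.mem_coe.mp hi)).2, (mem_filter.mp (Finset.mem_coe.mp hi')).2]
      exact sixPointPlusEnum_injective n hστ (Prod.ext h1 h2))
  simpa using h

/-- Each point carries at most two UNBARRED legs of the six-point word (`σ ≠ τ`). -/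
theorem card_filter_sixPointMinusEnum_fst_le_two (n : ℕ) {σ τ : Fin 2} (hστ : σ ≠ τ) (a : Fin (n + 2)) :
    (univ.filter fun i => (sixPointMinusEnum n σ τ i).1 = a).card ≤ 2 := by
  classical
  have h := Finset.card_le_card_of_injOn (fun i => (sixPointMinusEnum n σ τ i).2)
    (s := univ.filter fun i => (sixPointMinusEnum n σ τ i).1 = a) (t := (univ : Finset (Fin 2))) (fun i _ => mem_univ _)
    (fun i hi i' hi' h2 => by
      have h1 : (sixPointMinusEnum n σ τ i).1 = (sixPointMinusEnum n σ τ i').1 := by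
        rw [(mem_filter.mp (Finset.mem_coe.mp hi)).2, (mem_filter.mp (Finset.mem_coe.mp hi')).2]
      exact sixPointMinusEnum_injective n hστ (Prod.ext h1 h2))
  simpa using h

/-! ## §2 The six-point Grassmann word and its limiting Wick determinant -/

section Word

variable (L M : ℕ) [NeZero L]

/-- **The six-point word** `ψ⁺_{(z,s)σ}ψ⁻_{(0,0)σ} · ψ⁺_{(z,s)τ}ψ⁻_{(z,s)τ} · ψ⁺_{(0,0)τ}ψ⁻_{(0,0)τ}` (the split pair first, then the two
partner-spin densities; equal as a Grassmann element to `J̄_{z,s}·J_{0,0}`, `sixPointWord_eq_currents`). -/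
def sixPointWord (β : ℝ) (σ τ : Fin 2) (z : TorusSite 2 L) (s : ℝ) : HubbardGrassmann L M :=
  positionField L M β 0 σ z s * positionField L M β 1 σ 0 0 *
    (positionField L M β 0 τ z s * positionField L M β 1 τ z s) *
    (positionField L M β 0 τ 0 0 * positionField L M β 1 τ 0 0)

variable {M}

/-- **The limiting six-point Wick determinant** with `n` vertices at sites `x⃗` and times `t`: the determinant of the `vertexLimitEntry`'s between the
barred legs `sixPointPlusEnum` and the unbarred legs `sixPointMinusEnum` of the configuration `x⃗′ = (x⃗, z, 0)`, `t′ = (t, s, 0)` (midpoint values at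
equal times — the `M → ∞` limit of the integrands of `∫dμ_{C_M} (sixPointWord) Vⁿ`). -/
def sixPointLimitDet (β μ : ℝ) (σ τ : Fin 2) (z : TorusSite 2 L) (s : ℝ) {n : ℕ} (x : Fin n → TorusSite 2 L) (t : Fin n → ℝ) : ℂ :=
  (Matrix.of fun i j : Fin (n * 2 + 3) =>
    vertexLimitEntry L β μ ((Fin.append x ![z, 0] : Fin (n + 2) → TorusSite 2 L) (sixPointPlusEnum n σ τ i).1)
      ((Fin.append x ![z, 0] : Fin (n + 2) → TorusSite 2 L) (sixPointMinusEnum n σ τ j).1)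
      (sixPointPlusEnum n σ τ i).2 (sixPointMinusEnum n σ τ j).2
      ((Fin.append t ![s, 0] : Fin (n + 2) → ℝ) (sixPointMinusEnum n σ τ j).1 -
        (Fin.append t ![s, 0] : Fin (n + 2) → ℝ) (sixPointPlusEnum n σ τ i).1)).det

end Word

/-! ## §3 The word is `J̄_{z,s}·J_{0,0}`; the finite-cutoff moments are integrated Wick determinants -/

section Moments

variable {L M : ℕ} [NeZero L]

/-- Position–time fields are odd. -/
theorem positionField_mem_evenOdd_one (β : ℝ) (c ς : Fin 2) (y : TorusSite 2 L) (r : ℝ) :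
    positionField L M β c ς y r ∈ evenOdd ℂ (1 : ZMod 2) := by
  unfold positionField
  exact Submodule.sum_mem _ fun k _ => Submodule.smul_mem _ _ (gen_mem_evenOdd_one ℂ _)

/-- The six-point word IS the product of the two local cubic currents `J̄_{z,s} = ψ⁺_{(z,s)σ}ψ⁺_{(z,s)τ}ψ⁻_{(z,s)τ}` and
`J_{0,0} = ψ⁺_{(0,0)τ}ψ⁻_{(0,0)τ}ψ⁻_{(0,0)σ}` (an even pair commutes with everything; the lone `ψ⁻_{(0,0)σ}` moves past two even pairs). -/
theorem sixPointWord_eq_currents (β : ℝ) (σ τ : Fin 2) (z : TorusSite 2 L) (s : ℝ) :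
    sixPointWord L M β σ τ z s =
      (positionField L M β 0 σ z s * (positionField L M β 0 τ z s * positionField L M β 1 τ z s)) *
        ((positionField L M β 0 τ 0 0 * positionField L M β 1 τ 0 0) * positionField L M β 1 σ 0 0) := by
  -- the two density pairs are even, hence central
  have h2 : ((1 : ZMod 2) + 1) = 0 := by decide
  have hz : positionField L M β 0 τ z s * positionField L M β 1 τ z s ∈ evenOdd ℂ 0 := by
    have h := SetLike.mul_mem_graded (positionField_mem_evenOdd_one (L := L) (M := M) β 0 τ z s)
      (positionField_mem_evenOdd_one (L := L) (M := M) β 1 τ z s)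
    rwa [h2] at h
  have h0 : positionField L M β 0 τ 0 0 * positionField L M β 1 τ 0 0 ∈ evenOdd ℂ 0 := by
    have h := SetLike.mul_mem_graded (positionField_mem_evenOdd_one (L := L) (M := M) β 0 τ 0 0)
      (positionField_mem_evenOdd_one (L := L) (M := M) β 1 τ 0 0)
    rwa [h2] at h
  rw [sixPointWord]
  set A := positionField L M β 0 σ z s
  set B := positionField L M β 1 σ 0 0
  set P := positionField L M β 0 τ z s * positionField L M β 1 τ z s
  set Q := positionField L M β 0 τ 0 0 * positionField L M β 1 τ 0 0
  have hBP : B * P = P * B := (commute_of_mem_evenOdd_zero ℂ hz B).symm.eq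
  have hBQ : B * Q = Q * B := (commute_of_mem_evenOdd_zero ℂ h0 B).symm.eq
  calc A * B * P * Q = A * (B * P) * Q := by noncomm_ring
    _ = A * (P * B) * Q := by rw [hBP]
    _ = A * P * (B * Q) := by noncomm_ring
    _ = A * P * (Q * B) := by rw [hBQ]

/-- **The six-point moments at finite cutoff are integrated Wick determinants**:
`∫dμ_{C_M} (sixPointWord) Vⁿ = Uⁿ Σ_{x⃗∈Λⁿ} ∫_{[0,β]ⁿ} det[−(S′ᵀC_MS′)((P i,+),(Q j,−))]_{i,j < 2n+3} dt`, `S′` the substitution of the configuration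
`x⃗′ = (x⃗, z, 0)`, `t′ = (t, s, 0)`, `P = sixPointPlusEnum`, `Q = sixPointMinusEnum`. -/
theorem gaussExpect_sixPointWord_mul_hubbardInteraction_pow_eq_det {β : ℝ} (hβ : 0 < β) (μ U : ℝ) (σ τ : Fin 2) (z : TorusSite 2 L) (s : ℝ)
    (n : ℕ) :
    gaussExpect ℂ (hubbardCovariance L M β μ 0) (sixPointWord L M β σ τ z s * hubbardInteraction L M β U ^ n) =
      (U : ℂ) ^ n * ∑ x : Fin n → TorusSite 2 L, ∫ t in Set.Icc (0 : Fin n → ℝ) (fun _ => β),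
        (Matrix.of fun i j : Fin (n * 2 + 3) =>
          -((vertexSubMatrix L M β (Fin.append x ![z, 0]) (Fin.append t ![s, 0])).transpose * hubbardCovariance L M β μ 0 *
              vertexSubMatrix L M β (Fin.append x ![z, 0]) (Fin.append t ![s, 0]))
            ((sixPointPlusEnum n σ τ i, 0) : VertexLeg (n + 2)) ((sixPointMinusEnum n σ τ j, 1) : VertexLeg (n + 2))).det := by
  have key := linearMap_apply_hubbardInteraction_pow (L := L) (M := M) hβ U
    ((gaussExpect ℂ (hubbardCovariance L M β μ 0)).comp (LinearMap.mulLeft ℂ (sixPointWord L M β σ τ z s))) n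
  simp only [LinearMap.comp_apply, LinearMap.mulLeft_apply] at key
  rw [key]
  refine congrArg _ (sum_congr rfl fun x _ => integral_congr_ae (Filter.Eventually.of_forall fun t => ?_))
  simp only
  set x' : Fin (n + 2) → TorusSite 2 L := Fin.append x ![z, 0] with hx'
  set t' : Fin (n + 2) → ℝ := Fin.append t ![s, 0] with ht'
  have hword : (List.ofFn fun a => vertexFieldWord L M β x t a).prod =
      (List.ofFn fun a => vertexFieldWord L M β x' t' (Fin.castAdd 2 a)).prod := by
    congr 1
    refine congrArg List.ofFn (funext fun a => vertexFieldWord_congr β ?_ ?_)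
    · rw [hx', Fin.append_left]
    · rw [ht', Fin.append_left]
  -- the six external legs through the substitution of the extended configuration
  have hleg : ∀ (j c ς : Fin 2), positionField L M β c ς (![z, 0] j) (![s, (0:ℝ)] j) =
      ExteriorAlgebra.map (Matrix.toLin' (vertexSubMatrix L M β x' t')) (gen ℂ (((Fin.natAdd n j, ς), c) : VertexLeg (n + 2))) := by
    intro j c ς
    rw [map_vertexSub_gen_eq_positionField, hx', ht', Fin.append_right, Fin.append_right]
  have h0z := hleg 0 0 σ
  have h1z := hleg 0 0 τ
  have h2z := hleg 0 1 τ
  have h00 := hleg 1 1 σ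
  have h10 := hleg 1 0 τ
  have h20 := hleg 1 1 τ
  simp only [Matrix.cons_val_zero, Matrix.cons_val_one] at h0z h1z h2z h00 h10 h20
  rw [hword, prod_vertexFieldWord_comp_eq_map_genPairProd, sixPointWord, h0z, h1z, h2z, h00, h10, h20]
  simp only [← map_mul]
  rw [← gaussExpect_vertexWord_eq_det β μ x' t' (sixPointPlusEnum n σ τ) (sixPointMinusEnum n σ τ)]
  congr 2
  rw [genPairProd_succ (R := ℂ), genPairProd_succ (R := ℂ), genPairProd_succ (R := ℂ)]
  simp only [sixPointPlusEnum, sixPointMinusEnum, Fin.cons_zero]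
  simp only [mul_assoc]
  rfl

end Moments

end Summit.HubbardSuperconductivity.HubbardSuperconductivity.Theorems.TwoPointAssembly

end
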